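import Mathlib
import Literature.NumberTheory.DiophantineApproximation.KoksmaInequality
import Literature.Analysis.FunctionSpaces.BVIntegrationByParts
import HarnessLib

/-!
# Koksma's inequality for integrands of bounded variation (Kuipers–Niederreiter, Ch. 2 Thm 5.1)

Topic `Literature/NumberTheory/DiophantineApproximation`; PROVED theorems (no named fact).
Companion of `KoksmaInequality` (`Discrepancy.koksma`, the `C¹` form with `V(g) = ∫₀¹ |g'|`).
Here the integrand is merely of BOUNDED VARIATION — jumps allowed — which is the generality of the
published statement:

**Theorem 5.1** of [cite: KuipersNiederreiter1974, Ch. 2 Thm 5.1] (Koksma's inequality; also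
[cite: Niederreiter1992, Thm 2.9]): *let `g` be a function on `[0, 1]` of bounded variation `V(g)`,
and suppose we are given `N` points `y_1, …, y_N` in `[0, 1)` with (star) discrepancy `D*_N`.  Then
`|(1/N) Σ_{n ≤ N} g(y_n) - ∫₀¹ g(t) dt| ≤ V(g) D*_N`.*

## What is formalised

* `koksma_of_boundedVariationOn`: for `y ∈ [0,1)^N` (`N ≥ 1`), `g : ℝ → ℝ` with
  `BoundedVariationOn g (Icc 0 1)` and any `D` with `|Δ(t)| ≤ D` on `[0, 1]`, where
  `Δ(t) = #{n : y_n < t}/N - t` is the local discrepancy `Discrepancy.delta` of the LeVeque file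
  (so `sup |Δ| = D*_N`): `|(1/N) Σ_n g(y_n) - ∫₀¹ g| ≤ D · Var_{[0,1]} g`
  (`Var = (eVariationOn g (Icc 0 1)).toReal`).
* `koksma_boxDiscrepancy_of_boundedVariationOn`: the same with `D = boxDiscrepancy y`
  (CDT's box discrepancy, `≥ D*_N` by `abs_delta_le_boxDiscrepancy`), matching the shape of
  `Discrepancy.koksma`.

Proof (loc. cit., via Abel summation / Riemann–Stieltjes integration by parts): sort the points,
`0 = z_0 ≤ z_1 ≤ … ≤ z_N ≤ z_{N+1} = 1`; on the cell `[z_k, z_{k+1}]` one has `Δ(t) = k/N - t` for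
`z_k < t ≤ z_{k+1}`, hence `|t - k/N| ≤ D` on the closed cell, and the Stieltjes integration by parts
estimate `|∫_{z_k}^{z_{k+1}} g - [g(t)(t - k/N)]_{z_k}^{z_{k+1}}| ≤ D Var_{[z_k,z_{k+1}]} g`
(`Literature.Analysis.FunctionSpaces.abs_integral_mul_deriv_sub_le_mul_variation`,
Montgomery–Vaughan App. A); the boundary terms telescope to `(1/N) Σ_n g(y_n)` and the variations
add up (`eVariationOn.sum'`).

## References

* L. Kuipers, H. Niederreiter, *Uniform Distribution of Sequences*, Wiley 1974, Ch. 2 §5,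
  Theorem 5.1 (Koksma's inequality). [cite: KuipersNiederreiter1974, Ch. 2 Thm 5.1]
* H. Niederreiter, *Random Number Generation and Quasi-Monte Carlo Methods*, CBMS-NSF 63, SIAM
  1992, Theorem 2.9. [cite: Niederreiter1992, Thm 2.9]
* J. F. Koksma, *Een algemeene stelling uit de theorie der gelijkmatige verdeeling modulo 1*,
  Mathematica B (Zutphen) 11 (1942/43) 7–11 (the original).

AI-produced formalisation (H21 engines group, seat eng-quad-3, 2026-08-21); no facts, no axioms
beyond Mathlib's, no `sorry`.
-/

noncomputable section

namespace Literature.NumberTheory.DiophantineApproximation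

namespace Discrepancy

open MeasureTheory Set intervalIntegral Literature.Analysis.FunctionSpaces

variable {N : ℕ}

/-! ### Sorting the points -/

/-- The counting function is invariant under relabelling the points. [folklore] -/
private theorem countLT_comp_perm (y : Fin N → ℝ) (σ : Equiv.Perm (Fin N)) (t : ℝ) :
    countLT (y ∘ σ) t = countLT y t := by
  unfold countLT
  exact Finset.card_equiv σ fun i => by simp

/-- For sorted points `x_0 ≤ … ≤ x_{N-1}` and `x_{k-1} < t ≤ x_k` (with the obvious conventions for
`k = 0`, `k = N`), exactly `k` points lie below `t`. [folklore] -/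
private theorem countLT_eq_of_monotone {x : Fin N → ℝ} (hx : Monotone x) {k : ℕ} (hk : k ≤ N)
    {t : ℝ} (hlo : ∀ h : 0 < k, x ⟨k - 1, by omega⟩ < t) (hhi : ∀ h : k < N, t ≤ x ⟨k, h⟩) :
    countLT x t = k := by
  unfold countLT
  have hset : (Finset.univ.filter fun n : Fin N => x n < t) =
      Finset.univ.filter fun n : Fin N => (n : ℕ) < k := by
    ext n
    simp only [Finset.mem_filter, Finset.mem_univ, true_and]
    constructor
    · intro hnt
      by_contra hnk
      rw [not_lt] at hnk
      have hkN : k < N := lt_of_le_of_lt hnk n.isLt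
      have hmono : x ⟨k, hkN⟩ ≤ x n := hx (Fin.mk_le_of_le_val hnk)
      linarith [hhi hkN]
    · intro hnk
      have hk0 : 0 < k := by omega
      have hmono : x n ≤ x ⟨k - 1, by omega⟩ := hx (by
        rw [Fin.le_iff_val_le_val]
        dsimp only
        omega)
      linarith [hlo hk0]
  rw [hset, Fin.card_filter_val_lt, min_eq_right hk]

/-- A real function of bounded variation on `[a, b]` is interval integrable there (difference of
two monotone functions). [folklore] -/
private theorem intervalIntegrable_of_boundedVariationOn {a b : ℝ} (hab : a ≤ b) {g : ℝ → ℝ}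
    (hg : BoundedVariationOn g (Icc a b)) : IntervalIntegrable g volume a b := by
  obtain ⟨p, q, hp, hq, hpq, -⟩ := hg.locallyBoundedVariationOn.exists_monotoneOn_sub_monotoneOn'
  rw [hpq]
  exact (MonotoneOn.intervalIntegrable (by rwa [uIcc_of_le hab])).sub
    (MonotoneOn.intervalIntegrable (by rwa [uIcc_of_le hab]))

/-! ### Koksma's inequality, bounded-variation form -/

/-- **Koksma's inequality** for an integrand of bounded variation (Kuipers–Niederreiter Ch. 2
Thm 5.1; Niederreiter 1992 Thm 2.9): for points `y_1, …, y_N ∈ [0, 1)`, `g : ℝ → ℝ` of bounded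
variation on `[0, 1]` (jumps allowed) and any `D` with `|#{n : y_n < t}/N - t| ≤ D` for all
`t ∈ [0, 1]` (i.e. `D ≥ D*_N`, the star discrepancy):
`|(1/N) Σ_n g(y_n) - ∫₀¹ g| ≤ D · Var_{[0,1]} g`. [cite: KuipersNiederreiter1974, Ch. 2 Thm 5.1] -/
theorem koksma_of_boundedVariationOn (hN : 0 < N) {y : Fin N → ℝ} (hy0 : ∀ n, 0 ≤ y n)
    (hy1 : ∀ n, y n < 1) {g : ℝ → ℝ} (hg : BoundedVariationOn g (Icc (0 : ℝ) 1)) {D : ℝ}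
    (hD : ∀ t ∈ Icc (0 : ℝ) 1, |delta y t| ≤ D) :
    |(∑ n, g (y n)) / N - ∫ t in (0 : ℝ)..1, g t| ≤ D * (eVariationOn g (Icc (0 : ℝ) 1)).toReal := by
  classical
  have hNr : (0 : ℝ) < N := by exact_mod_cast hN
  have hD0 : 0 ≤ D := (abs_nonneg _).trans (hD 0 ⟨le_rfl, zero_le_one⟩)
  -- ### sort the points
  set σ : Equiv.Perm (Fin N) := Tuple.sort y with hσ
  set x : Fin N → ℝ := y ∘ σ with hxdef
  have hxm : Monotone x := Tuple.monotone_sort y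
  have hx0 : ∀ n, 0 ≤ x n := fun n => hy0 _
  have hx1 : ∀ n, x n < 1 := fun n => hy1 _
  have hsum : ∑ n, g (y n) = ∑ n, g (x n) := (Equiv.sum_comp σ (fun n => g (y n))).symm
  have hdelta : ∀ t, delta x t = delta y t := fun t => by
    simp only [delta, hxdef, countLT_comp_perm]
  -- ### the partition `0 = z 0 ≤ z 1 = x 0 ≤ … ≤ z N = x (N-1) ≤ z (N+1) = 1`
  set xe : ℕ → ℝ := fun i => if h : i < N then x ⟨i, h⟩ else 1 with hxe
  set z : ℕ → ℝ := fun k => if k = 0 then 0 else xe (k - 1) with hz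
  have hz0 : z 0 = 0 := by simp [hz]
  have hzs : ∀ k, z (k + 1) = xe k := fun k => by simp [hz]
  have hxe_lt : ∀ {i} (h : i < N), xe i = x ⟨i, h⟩ := fun h => by simp [hxe, h]
  have hxe_ge : ∀ {i}, N ≤ i → xe i = 1 := fun h => by simp [hxe, not_lt.mpr h]
  have hzN1 : z (N + 1) = 1 := by rw [hzs, hxe_ge le_rfl]
  have hxe01 : ∀ i, xe i ∈ Icc (0 : ℝ) 1 := fun i => by
    by_cases h : i < N
    · rw [hxe_lt h]; exact ⟨hx0 _, (hx1 _).le⟩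
    · rw [hxe_ge (not_lt.mp h)]; exact ⟨zero_le_one, le_rfl⟩
  have hzIcc : ∀ k, z k ∈ Icc (0 : ℝ) 1 := fun k => by
    rcases k with _ | k
    · rw [hz0]; exact ⟨le_rfl, zero_le_one⟩
    · rw [hzs]; exact hxe01 k
  have hxemono : ∀ i, xe i ≤ xe (i + 1) := fun i => by
    by_cases h1 : i + 1 < N
    · rw [hxe_lt (by omega), hxe_lt h1]
      exact hxm (by rw [Fin.le_iff_val_le_val]; dsimp only; omega)
    · rw [hxe_ge (i := i + 1) (by omega)]
      exact (hxe01 i).2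
  have hzmono : Monotone z := by
    refine monotone_nat_of_le_succ fun k => ?_
    rcases k with _ | k
    · rw [hz0, hzs]; exact (hxe01 0).1
    · rw [hzs, hzs]; exact hxemono k
  have hxz : ∀ n : Fin N, x n = z ((n : ℕ) + 1) := fun n => by
    rw [hzs, hxe_lt n.isLt]
  -- ### the per-cell estimate
  have hcell : ∀ k ≤ N,
      |(∫ t in z k..z (k + 1), g t) -
          (g (z (k + 1)) * (z (k + 1) - k / N) - g (z k) * (z k - k / N))| ≤
        D * (eVariationOn g (Icc (z k) (z (k + 1)))).toReal := by
    intro k hk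
    rcases (hzmono (Nat.le_succ k)).eq_or_lt with heq | hlt
    · -- degenerate cell: everything vanishes
      rw [← heq, intervalIntegral.integral_same, sub_self, zero_sub, abs_neg, abs_zero]
      positivity
    · -- `Δ(t) = k/N - t` on `(z k, z (k+1)]`, hence `|t - k/N| ≤ D` there
      have hIoc : ∀ t ∈ Ioc (z k) (z (k + 1)), |t - k / N| ≤ D := by
        intro t ht
        have ht01 : t ∈ Icc (0 : ℝ) 1 := ⟨(hzIcc k).1.trans ht.1.le, ht.2.trans (hzIcc (k + 1)).2⟩
        have hc : countLT x t = k := by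
          refine countLT_eq_of_monotone hxm hk (fun h0 => ?_) fun hkN => ?_
          · obtain ⟨j, rfl⟩ : ∃ j, k = j + 1 := ⟨k - 1, by omega⟩
            have h1 : z (j + 1) = x ⟨j, by omega⟩ := by rw [hzs, hxe_lt (by omega)]
            have h2 : x ⟨j + 1 - 1, by omega⟩ = x ⟨j, by omega⟩ := rfl
            rw [h2, ← h1]
            exact ht.1
          · have h1 : z (k + 1) = x ⟨k, hkN⟩ := by rw [hzs, hxe_lt hkN]
            rw [← h1]
            exact ht.2
        have hdt : delta y t = k / N - t := by rw [← hdelta, delta, hc]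
        have h := hD t ht01
        rwa [hdt, abs_sub_comm] at h
      -- … and, by approach from the right, also at the left endpoint
      have hM : ∀ t ∈ Icc (z k) (z (k + 1)), |t - k / N| ≤ D := by
        intro t ht
        rcases ht.1.eq_or_lt with hzt | hlt'
        · rw [← hzt, abs_le]
          constructor
          · have key : ∀ ε > 0, (k : ℝ) / N - z k ≤ D + ε := by
              intro ε hε
              have hs : min (z k + ε) (z (k + 1)) ∈ Ioc (z k) (z (k + 1)) :=
                ⟨lt_min (by linarith) hlt, min_le_right _ _⟩
              have h1 := (abs_le.mp (hIoc _ hs)).1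
              have h2 : min (z k + ε) (z (k + 1)) ≤ z k + ε := min_le_left _ _
              linarith
            have := le_of_forall_pos_le_add key
            linarith
          · have h1 := (abs_le.mp (hIoc (z (k + 1)) ⟨hlt, le_rfl⟩)).2
            linarith
        · exact hIoc t ⟨hlt', ht.2⟩
      have hgk : BoundedVariationOn g (Icc (z k) (z (k + 1))) :=
        hg.mono (Icc_subset_Icc (hzIcc k).1 (hzIcc (k + 1)).2)
      have h := abs_integral_mul_deriv_sub_le_mul_variation hlt.le hgk
        (Φ := fun t => t - k / N) (ψ := fun _ => (1 : ℝ))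
        (fun t _ => (hasDerivAt_id t).sub_const _) continuousOn_const hM
      simpa only [mul_one] using h
  -- ### summing the cells: integrals, boundary terms, variations
  have hint : ∀ k < N + 1, IntervalIntegrable g volume (z k) (z (k + 1)) := fun k _ =>
    intervalIntegrable_of_boundedVariationOn (hzmono (Nat.le_succ k))
      (hg.mono (Icc_subset_Icc (hzIcc k).1 (hzIcc (k + 1)).2))
  have hI : ∑ k ∈ Finset.range (N + 1), ∫ t in z k..z (k + 1), g t = ∫ t in (0 : ℝ)..1, g t := by
    rw [sum_integral_adjacent_intervals hint, hz0, hzN1]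
  have hB : ∑ k ∈ Finset.range (N + 1),
      (g (z (k + 1)) * (z (k + 1) - k / N) - g (z k) * (z k - k / N)) = (∑ n, g (x n)) / N := by
    have h1 : ∀ k : ℕ, g (z (k + 1)) * (z (k + 1) - k / N) - g (z k) * (z k - k / N) =
        (g (z (k + 1)) * (z (k + 1) - ((k + 1 : ℕ) : ℝ) / N) - g (z k) * (z k - k / N)) +
          g (z (k + 1)) / N := by
      intro k
      push_cast
      field_simp
      ring
    simp_rw [h1]
    rw [Finset.sum_add_distrib, Finset.sum_range_sub (fun k => g (z k) * (z k - k / N)), hz0, hzN1,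
      Finset.sum_range_succ, hzN1, ← Finset.sum_div]
    have hS : ∑ k ∈ Finset.range N, g (z (k + 1)) = ∑ n, g (x n) := by
      rw [← Fin.sum_univ_eq_sum_range (fun k => g (z (k + 1))) N]
      exact Finset.sum_congr rfl fun n _ => by rw [hxz n]
    rw [hS]
    push_cast
    field_simp
    ring
  have hfin : ∀ k ∈ Finset.range (N + 1), eVariationOn g (Icc (z k) (z (k + 1))) ≠ ⊤ := fun k _ =>
    hg.mono (Icc_subset_Icc (hzIcc k).1 (hzIcc (k + 1)).2)
  have hV : ∑ k ∈ Finset.range (N + 1), (eVariationOn g (Icc (z k) (z (k + 1)))).toReal =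
      (eVariationOn g (Icc (0 : ℝ) 1)).toReal := by
    rw [← ENNReal.toReal_sum hfin, eVariationOn.sum' g hzmono, hz0, hzN1]
  -- ### assemble
  have hE : (∫ t in (0 : ℝ)..1, g t) - (∑ n, g (y n)) / N =
      ∑ k ∈ Finset.range (N + 1), ((∫ t in z k..z (k + 1), g t) -
        (g (z (k + 1)) * (z (k + 1) - k / N) - g (z k) * (z k - k / N))) := by
    rw [Finset.sum_sub_distrib, hI, hB, hsum]
  rw [abs_sub_comm, hE]
  calc |∑ k ∈ Finset.range (N + 1), ((∫ t in z k..z (k + 1), g t) -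
          (g (z (k + 1)) * (z (k + 1) - k / N) - g (z k) * (z k - k / N)))|
      ≤ ∑ k ∈ Finset.range (N + 1), |(∫ t in z k..z (k + 1), g t) -
          (g (z (k + 1)) * (z (k + 1) - k / N) - g (z k) * (z k - k / N))| :=
        Finset.abs_sum_le_sum_abs _ _
    _ ≤ ∑ k ∈ Finset.range (N + 1), D * (eVariationOn g (Icc (z k) (z (k + 1)))).toReal :=
        Finset.sum_le_sum fun k hk => hcell k (by rw [Finset.mem_range] at hk; omega)
    _ = D * (eVariationOn g (Icc (0 : ℝ) 1)).toReal := by rw [← Finset.mul_sum, hV]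

/-- **Koksma's inequality**, bounded-variation form, with CDT's box discrepancy (the shape of
`Discrepancy.koksma`): for `y ∈ [0,1)^N` and `g` of bounded variation on `[0, 1]`,
`|(1/N) Σ_n g(y_n) - ∫₀¹ g| ≤ D_N(y) · Var_{[0,1]} g` (`D_N = boxDiscrepancy y ≥ D*_N`).
[cite: KuipersNiederreiter1974, Ch. 2 Thm 5.1] -/
theorem koksma_boxDiscrepancy_of_boundedVariationOn (hN : 0 < N) {y : Fin N → ℝ}
    (hy0 : ∀ n, 0 ≤ y n) (hy1 : ∀ n, y n < 1) {g : ℝ → ℝ}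
    (hg : BoundedVariationOn g (Icc (0 : ℝ) 1)) :
    |(∑ n, g (y n)) / N - ∫ t in (0 : ℝ)..1, g t| ≤
      boxDiscrepancy y * (eVariationOn g (Icc (0 : ℝ) 1)).toReal :=
  koksma_of_boundedVariationOn hN hy0 hy1 hg fun _ ht => abs_delta_le_boxDiscrepancy hy0 ht

end Discrepancy

end Literature.NumberTheory.DiophantineApproximation

end
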